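import Summits.CriticalPhenomena.SAWScalingLimit.Theorems.SAWLeftRightFKGLeftRightFKGTP2Defs
import Summits.CriticalPhenomena.SAWScalingLimit.Theorems.SAWTotalPositivityBoundaryTP2Symmetry
import Summits.CriticalPhenomena.SAWScalingLimit.Theorems.SAWTotalPositivityBoundaryTP2CutVertex
import Literature.Combinatorics.SimpleGraph.MengerTwo
import HarnessLib

/-!
# Stub `stub_allMeetProportional` of line `corner-localisation`: all-meet gives proportional kernel rows

Crux `LeftRightFKG` (stmt-CriticalPhenomena-11232), line `corner-localisation` (lead c1 reshape v5), stub
`stub_allMeetProportional`; vocabulary module `…LeftRightFKGTP2Defs` (`AllMeetProportionalAt`).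

THE STATEMENT (pure graph theory, every fugacity `x > 0`). In a graph `H` let `u ≠ u'` and let `T` be a set of
target vertices such that every self-avoiding path from `u` to `T` shares a vertex with every self-avoiding
path from `u'` to `T`. Then the two rows of the self-avoiding path kernel
`Z(a,b) = BoundaryTP2.pathKernel H x a b = Σ_{γ : a → b} x^{|γ|}` restricted to `T` are proportional:
`Z(u,w) Z(u',w') = Z(u,w') Z(u',w)` for `w, w' ∈ T`.

THE PROOF. Menger's theorem for two paths between the vertex sets `S = {u, u'}` and `T`
(`Literature.Combinatorics.SimpleGraph.exists_mem_support_forall`, admissible set = everything): two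
vertex-disjoint `S`–`T` paths would start at the two different vertices `u`, `u'` and contradict the
hypothesis, so — unless no `S`–`T` walk exists at all, in which case the row of `u` vanishes on `T` — ONE
vertex `z` lies on every `S`–`T` walk. Put `B = {z} ∪ {v | v reaches T by a walk avoiding z}` and
`A = {z} ∪ Bᶜ`: then `A ∪ B` is everything, `A ∩ B = {z}`, every edge of `H` lies inside `A` or inside `B`
(reaching `T` off `z` propagates along edges not at `z`), `S ⊆ A` (a walk from `S` to `T` avoiding `z` does not
exist) and `T ⊆ B`; the cut-vertex factorisation `BoundaryTP2.stub_cutVertex_factor` gives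
`Z(s,t) = Z_A(s,z) Z_B(z,t)` for `s ∈ S`, `t ∈ T`, and the identity is commutativity of `ℝ≥0∞`.
-/

noncomputable section

open MeasureTheory
open Literature.Probability.LatticeModels Literature.Probability.RandomPlanarGeometry
open scoped Classical ENNReal

namespace Summit.CriticalPhenomena.SAWScalingLimit.Theorems.LeftRightFKG.CornerLoc

namespace AllMeetProportional

variable {V : Type*}

/-- PROPAGATION ALONG AN EDGE: if `a ∼ b`, `a` reaches the target set `T` by a walk avoiding `z` and
`b ≠ z`, then `b` reaches `T` by a walk avoiding `z` (prepend the edge). [folklore] -/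
theorem reach_avoid_of_adj (H : SimpleGraph V) (T : Set V) (z : V) {a b : V} (hab : H.Adj a b)
    (ha : ∃ t ∈ T, ∃ q : H.Walk a t, z ∉ q.support) (hbz : b ≠ z) :
    ∃ t ∈ T, ∃ q : H.Walk b t, z ∉ q.support := by
  obtain ⟨t, ht, q, hq⟩ := ha
  refine ⟨t, ht, SimpleGraph.Walk.cons hab.symm q, ?_⟩
  rw [SimpleGraph.Walk.support_cons, List.mem_cons]
  rintro (h | h)
  · exact hbz h.symm
  · exact hq h

/-- FACTORISATION THROUGH A ONE-VERTEX CUT BETWEEN VERTEX SETS. If the vertex `z` lies on every walk from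
`S` to `T`, then for `0 ≤ x` the path kernel factorises on `S × T`: `Z_H(s,t) = K_A(s) · K_B(t)` for `s ∈ S`,
`t ∈ T` — the cut-vertex factorisation `BoundaryTP2.stub_cutVertex_factor` for
`B = {z} ∪ {v | v reaches T by a walk avoiding z}` and `A = {z} ∪ Bᶜ` (`K_A(s) = Z_A(s,z)`,
`K_B(t) = Z_B(z,t)`, kernels of the two induced pieces). [folklore] -/
theorem factor_of_cut (H : SimpleGraph V) (x : ℝ) (hx : 0 ≤ x) (S T : Set V) (z : V)
    (hz : ∀ (s t : V) (q : H.Walk s t), s ∈ S → t ∈ T → z ∈ q.support) :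
    ∃ KA KB : V → ℝ≥0∞, ∀ s t, s ∈ S → t ∈ T → BoundaryTP2.pathKernel H x s t = KA s * KB t := by
  classical
  obtain ⟨B, hB⟩ : ∃ B : Set V, B = {v | v = z ∨ ∃ t ∈ T, ∃ q : H.Walk v t, z ∉ q.support} :=
    ⟨_, rfl⟩
  obtain ⟨A, hA⟩ : ∃ A : Set V, A = {v | v = z ∨ v ∉ B} := ⟨_, rfl⟩
  have hzA : z ∈ A := by rw [hA, Set.mem_setOf_eq]; exact Or.inl rfl
  have hzB : z ∈ B := by rw [hB, Set.mem_setOf_eq]; exact Or.inl rfl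
  have hnA : ∀ v, v ∉ B → v ∈ A := fun v hv => by rw [hA, Set.mem_setOf_eq]; exact Or.inr hv
  have hAB : ∀ v, v ∈ A ∨ v ∈ B := fun v => by
    by_cases h : v ∈ B
    · exact Or.inr h
    · exact Or.inl (hnA v h)
  have hc : ∀ v, v ∈ A → v ∈ B → v = z := fun v hvA hvB => by
    rw [hA, Set.mem_setOf_eq] at hvA
    exact hvA.elim id fun h => absurd hvB h
  -- reaching `T` off `z` propagates along edges not at `z`
  have hprop : ∀ a b, H.Adj a b → a ∈ B → a ≠ z → b ∈ B := fun a b hab haB haz => by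
    rw [hB, Set.mem_setOf_eq] at haB ⊢
    by_cases hbz : b = z
    · exact Or.inl hbz
    · exact Or.inr (reach_avoid_of_adj H T z hab (haB.resolve_left haz) hbz)
  have hsep : ∀ a b, H.Adj a b → (a ∈ A ∧ b ∈ A) ∨ (a ∈ B ∧ b ∈ B) := fun a b hab => by
    by_cases haB : a ∈ B <;> by_cases hbB : b ∈ B
    · exact Or.inr ⟨haB, hbB⟩
    · have haz : a = z := by
        by_contra haz
        exact hbB (hprop a b hab haB haz)
      exact Or.inl ⟨by rw [haz]; exact hzA, hnA b hbB⟩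
    · have hbz : b = z := by
        by_contra hbz
        exact haB (hprop b a hab.symm hbB hbz)
      exact Or.inl ⟨hnA a haB, by rw [hbz]; exact hzA⟩
    · exact Or.inl ⟨hnA a haB, hnA b hbB⟩
  -- `S ⊆ A`: a walk from `S` to `T` avoiding `z` does not exist
  have hS : ∀ s, s ∈ S → s ∈ A := fun s hs => by
    by_cases hsz : s = z
    · rw [hsz]; exact hzA
    · refine hnA s fun hsB => ?_
      rw [hB, Set.mem_setOf_eq] at hsB
      rcases hsB with h | ⟨t, ht, q, hq⟩
      · exact hsz h
      · exact hq (hz s t q hs ht)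
  -- `T ⊆ B`: the trivial walk
  have hT : ∀ t, t ∈ T → t ∈ B := fun t ht => by
    rw [hB, Set.mem_setOf_eq]
    by_cases htz : t = z
    · exact Or.inl htz
    · refine Or.inr ⟨t, ht, SimpleGraph.Walk.nil, ?_⟩
      rw [SimpleGraph.Walk.support_nil, List.mem_singleton]
      exact fun h => htz h.symm
  exact ⟨fun s => BoundaryTP2.pathKernel (SimpleGraph.fromRel fun a b => H.Adj a b ∧ a ∈ A ∧ b ∈ A) x s z,
    fun t => BoundaryTP2.pathKernel (SimpleGraph.fromRel fun a b => H.Adj a b ∧ a ∈ B ∧ b ∈ B) x z t,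
    fun s t hs ht =>
      BoundaryTP2.stub_cutVertex_factor H x hx A B z s t hAB hc hzA hzB hsep (hS s hs) (hT t ht)⟩

/-- ALL-MEET GIVES A ONE-VERTEX CUT (Menger, `k = 2`, `S = {u, u'}`): if every self-avoiding path from `u`
to `T` meets every self-avoiding path from `u'` to `T`, and some walk from `u` or `u'` reaches `T`, then one
vertex lies on every walk from `u` or `u'` to `T`. [cite: Diestel2017, Thm. 3.3.1] -/
theorem exists_cut_of_allMeet (H : SimpleGraph V) (u u' : V) (T : Set V)
    (hmeet : ∀ (w w' : V) (P : H.Path u w) (Q : H.Path u' w'), w ∈ T → w' ∈ T →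
      ∃ v, v ∈ P.1.support ∧ v ∈ Q.1.support)
    (hone : ∃ (s t : V) (q : H.Walk s t), s ∈ ({s | s = u ∨ s = u'} : Set V) ∧ t ∈ T ∧
      ∀ y ∈ q.support, y ∈ (Set.univ : Set V)) :
    ∃ z : V, ∀ (s t : V) (q : H.Walk s t), s ∈ ({s | s = u ∨ s = u'} : Set V) → t ∈ T →
      z ∈ q.support := by
  obtain ⟨z, -, hz⟩ := Literature.Combinatorics.SimpleGraph.exists_mem_support_forall
    (G := H) (A := Set.univ) (S := {s | s = u ∨ s = u'}) (T := T) hone (by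
      rintro ⟨s₁, t₁, s₂, t₂, p₁, p₂, hs₁, ht₁, hs₂, ht₂, hp₁, hp₂, -, -, hdisj⟩
      have hne : s₁ ≠ s₂ := by
        rintro rfl
        exact hdisj s₁ p₁.start_mem_support p₂.start_mem_support
      rw [Set.mem_setOf_eq] at hs₁ hs₂
      rcases hs₁ with rfl | rfl <;> rcases hs₂ with rfl | rfl
      · exact hne rfl
      · obtain ⟨v, hv₁, hv₂⟩ := hmeet t₁ t₂ ⟨p₁, hp₁⟩ ⟨p₂, hp₂⟩ ht₁ ht₂
        exact hdisj v hv₁ hv₂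
      · obtain ⟨v, hv₂, hv₁⟩ := hmeet t₂ t₁ ⟨p₂, hp₂⟩ ⟨p₁, hp₁⟩ ht₂ ht₁
        exact hdisj v hv₁ hv₂
      · exact hne rfl)
  exact ⟨z, fun s t q hs ht => hz s t q hs ht fun y _ => Set.mem_univ y⟩

end AllMeetProportional

/-- REGISTERED STUB `stub_allMeetProportional` of line `corner-localisation` (ALL-MEET ⇒ PROPORTIONAL ROWS,
every fugacity `x > 0`): if every self-avoiding path from `u` to the target set `T` shares a vertex with every
self-avoiding path from `u' ≠ u` to `T`, then `Z(u,w) Z(u',w') = Z(u,w') Z(u',w)` for `w, w' ∈ T` — Menger's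
theorem for two paths gives one vertex on every `{u,u'}`–`T` walk and the cut-vertex factorisation of the path
kernel factors both rows through it (if no `{u,u'}`–`T` walk exists, the row of `u` vanishes on `T`).
[cite: Diestel2017, Thm. 3.3.1] -/
theorem stub_allMeetProportional : ∀ x : ℝ, 0 < x → AllMeetProportionalAt x := by
  intro x hx H _ u u' T _ hmeet w w' hw hw'
  by_cases hone : ∃ (s t : Site 2) (q : H.Walk s t), s ∈ ({s | s = u ∨ s = u'} : Set (Site 2)) ∧
      t ∈ T ∧ ∀ y ∈ q.support, y ∈ (Set.univ : Set (Site 2))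
  · obtain ⟨z, hz⟩ := AllMeetProportional.exists_cut_of_allMeet H u u' T hmeet hone
    obtain ⟨KA, KB, hK⟩ :=
      AllMeetProportional.factor_of_cut H x hx.le {s | s = u ∨ s = u'} T z hz
    rw [hK u w (Or.inl rfl) hw, hK u' w' (Or.inr rfl) hw', hK u w' (Or.inl rfl) hw',
      hK u' w (Or.inr rfl) hw]
    ring
  · have h0 : ∀ t, t ∈ T → BoundaryTP2.pathKernel H x u t = 0 := fun t ht =>
      BoundaryTP2.pathKernel_eq_zero_of_not_reachable H x fun h =>
        h.elim fun q => hone ⟨u, t, q, Or.inl rfl, ht, fun y _ => Set.mem_univ y⟩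
    rw [h0 w hw, h0 w' hw', zero_mul, zero_mul]

end Summit.CriticalPhenomena.SAWScalingLimit.Theorems.LeftRightFKG.CornerLoc

end
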